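import Summits.AtomisticToContinuum.HydrodynamicLimit.Theses.MourreKoopmanCharges
import HarnessLib

/-!
# `OneBodySectorRigidity` (support item stmt-AtomisticToContinuum-14143, route `MourreKoopmanCharges`):
# helper lemmas — cell observables under hard-core data, the static half of rigidity, and the
# reduction of the item to the short-time `√t`-dichotomy on the closed one-body sector

The item (route decl `…Theses.MourreKoopmanCharges.OneBodySectorRigidity`): under the low-activity
hard-sphere Gibbs state with flow a.e. equal to an equilibrium Alexander flow,
`F.oneBodySector ⊓ F.generatorDomain ≤ F.chargeSpace` — a vector of the CLOSED one-body sector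
`𝒟 = closure span{[A_h] : A_h ∈ 𝒱}` at which `t ↦ U_t ψ` is differentiable is a combination of the
five charge classes.

This file lands the parts of the intended proof (Spohn 1991 Part I §7.1; CIP 1994 §7.2) that are
provable against the carriers `HardSphereFluctuationData` / `FluctuationSpace`:

* hard core (`σ > 0`) ⟹ a.s. finitely many particles in the unit cell
  (`ae_cellPoints_finite`, via `IsHardCore.posLocallyFinite`), hence the cell observables
  `A_h = Σ_{qᵢ ∈ [0,1)³} h(vᵢ)` are finite sums and `h ↦ A_h` is linear almost everywhere
  (`cellObs_eq_sum`, `cellObs_finset_sum_ae`);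
* the STATIC half of rigidity (`fluct_mem_chargeSpace_of_ae_eq_cellObs`): if `a ∈ 𝒱` is a.e. a
  cell observable `A_h` whose profile `h` is a collision invariant (`span{1, v_α, |v|²}` =
  `Literature.Analysis.UnboundedOperators.collisionInvariants V3` = `span (range chargeFn)`,
  `span_range_chargeFn_eq_collisionInvariants`), then `[a] ∈ 𝒞`;
* the DYNAMICAL consumption point: on `generatorDomain`, `U_t ψ − ψ = O(t)` hence
  `‖U_t ψ − ψ‖² = o(t)` as `t → 0⁺` (`isLittleO_norm_koopman_sub_self_sq`), and the reduction
  `oneBodySectorRigidity_of_sqrt_dichotomy`: the item follows from the `√t`-dichotomy "every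
  `ψ ∈ 𝒟` with `‖U_t ψ − ψ‖² = o(t)` is a charge", stated on the CLOSURE `𝒟`.

What is NOT here: the dichotomy itself. For `ψ = [A_h]` with `h` of temperate growth the expected
short-time law is `t⁻¹ ‖U_t ψ − ψ‖² → κ · (−⟨h, L h⟩_M)` with `κ > 0` (collision frequency of the
Gibbs state) and `L` the linearised hard-sphere operator, whose kernel on functions of temperate
growth is the collision invariants (PROVED:
`Literature.MathematicalPhysics.KineticTheory.hardSphereLinearizedOp_eq_zero_iff_mem_collisionInvariants_holds`);
this pointwise law (Lebowitz–Percus–Sykes 1969, formal thermodynamic limit) is not a theorem for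
Alexander's infinite-volume flow, and even granted it does not reach the closure `𝒟`: the functional
`ψ ↦ lim_{t→0⁺} t⁻¹‖U_t ψ − ψ‖²` of a unitary group is not lower semicontinuous, so a remainder
estimate uniform over one-body profiles (or the dichotomy stated on `𝒟` directly, hypothesis `H`
of `oneBodySectorRigidity_of_sqrt_dichotomy`) is required. See the item's evidence note.

References: H. Spohn, *Large Scale Dynamics of Interacting Particles* (1991), Part I §7.1;
C. Cercignani, R. Illner, M. Pulvirenti, *The Mathematical Theory of Dilute Gases* (1994), §7.2;
R. Alexander, Comm. Math. Phys. 49 (1976) §1.4; J. L. Lebowitz, J. K. Percus, J. Sykes,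
Phys. Rev. 188 (1969) 487.
-/

noncomputable section

namespace Summit.AtomisticToContinuum.HydrodynamicLimit.Theorems.OneBodySectorRigidity

open MeasureTheory Filter Set Function
open scoped InnerProductSpace Topology
open Literature.Analysis.FunctionSpaces (PointConfig)
open Literature.Analysis.FluidPDE Literature.MathematicalPhysics.KineticTheory

variable {σ : ℝ}

/-! ## Particles in the unit cell -/

/-! Throughout, the *cell points* of a marked configuration `ω` are the particles whose position
lies in the unit cell, the set `(ω : Set (V3 × V3)) ∩ Prod.fst ⁻¹' unitCell` (written out, no
definition is introduced). -/

/-- The unit cell is contained in the closed ball of radius `2`. [folklore] -/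
theorem unitCell_subset_closedBall : unitCell ⊆ Metric.closedBall (0 : V3) 2 := by
  intro q hq
  rw [Metric.mem_closedBall, dist_zero_right, EuclideanSpace.norm_eq]
  have h1 : ∀ i, ‖q i‖ ^ 2 ≤ 1 := fun i => by
    have := hq i
    rw [Real.norm_eq_abs, sq_le_one_iff_abs_le_one, abs_abs, abs_le]
    constructor <;> linarith [this.1, this.2]
  have h2 : ∑ i, ‖q i‖ ^ 2 ≤ 3 := by
    calc ∑ i, ‖q i‖ ^ 2 ≤ ∑ _i : Fin 3, (1 : ℝ) := Finset.sum_le_sum fun i _ => h1 i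
      _ = 3 := by simp
  calc Real.sqrt (∑ i, ‖q i‖ ^ 2) ≤ Real.sqrt 4 := Real.sqrt_le_sqrt (by linarith)
    _ = 2 := by
      rw [show (4 : ℝ) = 2 ^ 2 by norm_num, Real.sqrt_sq (by norm_num)]

/-- A hard-sphere configuration (`σ > 0`) has finitely many particles in the unit cell
(Alexander 1976 §1.4: hard core forces local finiteness in the position coordinate). [folklore] -/
theorem cellPoints_finite_of_isHardCore (hσ : 0 < σ) {ω : MarkedConfig} (h : IsHardCore σ ω) :
    ((ω : Set (V3 × V3)) ∩ Prod.fst ⁻¹' unitCell).Finite :=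
  ((h.posLocallyFinite hσ) _ (isCompact_closedBall (0 : V3) 2)).subset
    (inter_subset_inter_right _ (preimage_mono unitCell_subset_closedBall))

/-- Under hard-sphere fluctuation data with `σ > 0`, almost every configuration has finitely many
particles in the unit cell. [folklore] -/
theorem ae_cellPoints_finite (F : HardSphereFluctuationData σ) (hσ : 0 < σ) :
    ∀ᵐ ω : MarkedConfig ∂F.μ, Set.Finite ((ω : Set (V3 × V3)) ∩ Prod.fst ⁻¹' unitCell) := by
  filter_upwards [F.hardCore] with ω hω
  refine cellPoints_finite_of_isHardCore hσ (fun p hp q hq hpq => ?_)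
  have h' : σ ≤ dist p.1 q.1 := hω hp hq hpq
  rwa [dist_eq_norm] at h'

/-! ## Cell observables as finite sums; almost-everywhere linearity -/

/-- `A_h(ω) = Σ_{p ∈ ω, p.1 ∈ [0,1)³} h(p.2)` as a `finsum` over the cell points. [folklore] -/
theorem cellObs_eq_finsum_mem (h : V3 → ℝ) (ω : MarkedConfig) :
    cellObs h ω = ∑ᶠ p ∈ (ω : Set (V3 × V3)) ∩ Prod.fst ⁻¹' unitCell, h p.2 := by
  unfold cellObs linStat
  have e : (fun p : V3 × V3 => unitCell.indicator (fun _ => h p.2) p.1) =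
      (Prod.fst ⁻¹' unitCell).indicator (fun p => h p.2) := by
    funext p
    by_cases hp : p.1 ∈ unitCell <;> simp [hp]
  rw [finsum_mem_def, finsum_mem_def, e, Set.indicator_indicator]

/-- On a configuration with finitely many cell points, `A_h` is a finite sum. [folklore] -/
theorem cellObs_eq_sum (h : V3 → ℝ) {ω : MarkedConfig} (hω : ((ω : Set (V3 × V3)) ∩ Prod.fst ⁻¹' unitCell).Finite) :
    cellObs h ω = ∑ p ∈ hω.toFinset, h p.2 := by
  rw [cellObs_eq_finsum_mem, finsum_mem_eq_finite_toFinset_sum]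

/-- Additivity of `h ↦ A_h(ω)` on configurations with finitely many cell points. [folklore] -/
theorem cellObs_add (h₁ h₂ : V3 → ℝ) {ω : MarkedConfig} (hω : ((ω : Set (V3 × V3)) ∩ Prod.fst ⁻¹' unitCell).Finite) :
    cellObs (h₁ + h₂) ω = cellObs h₁ ω + cellObs h₂ ω := by
  simp only [cellObs_eq_sum _ hω, Pi.add_apply, Finset.sum_add_distrib]

/-- Homogeneity of `h ↦ A_h(ω)` on configurations with finitely many cell points. [folklore] -/
theorem cellObs_smul (c : ℝ) (h : V3 → ℝ) {ω : MarkedConfig} (hω : ((ω : Set (V3 × V3)) ∩ Prod.fst ⁻¹' unitCell).Finite) :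
    cellObs (c • h) ω = c * cellObs h ω := by
  simp only [cellObs_eq_sum _ hω, Pi.smul_apply, smul_eq_mul, Finset.mul_sum]

/-- Finite linear combinations: `A_{Σ cᵢ hᵢ}(ω) = Σ cᵢ A_{hᵢ}(ω)` on configurations with finitely
many cell points. [folklore] -/
theorem cellObs_finset_sum {ι : Type*} (s : Finset ι) (c : ι → ℝ) (h : ι → V3 → ℝ)
    {ω : MarkedConfig} (hω : ((ω : Set (V3 × V3)) ∩ Prod.fst ⁻¹' unitCell).Finite) :
    cellObs (∑ i ∈ s, c i • h i) ω = ∑ i ∈ s, c i * cellObs (h i) ω := by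
  classical
  induction s using Finset.induction_on with
  | empty => simp [cellObs_eq_sum _ hω]
  | insert i s hi ih => rw [Finset.sum_insert hi, Finset.sum_insert hi, cellObs_add _ _ hω,
      cellObs_smul _ _ hω, ih]

/-- Almost-everywhere linearity of the cell observables under hard-sphere data (`σ > 0`):
`A_{Σ cᵢ hᵢ} = Σ cᵢ A_{hᵢ}` `μ`-a.e. [folklore] -/
theorem cellObs_finset_sum_ae (F : HardSphereFluctuationData σ) (hσ : 0 < σ) {ι : Type*}
    (s : Finset ι) (c : ι → ℝ) (h : ι → V3 → ℝ) :
    cellObs (∑ i ∈ s, c i • h i) =ᵐ[F.μ] ∑ i ∈ s, c i • cellObs (h i) := by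
  filter_upwards [ae_cellPoints_finite F hσ] with ω hω
  rw [cellObs_finset_sum s c h hω, Finset.sum_apply]
  simp only [Pi.smul_apply, smul_eq_mul]


/-! ## The static half of rigidity: one-body observables with collision-invariant profile are charges -/

/-- The class map is linear on finite combinations of local observables. [folklore] -/
theorem fluct_finset_sum (F : HardSphereFluctuationData σ) {ι : Type*} (s : Finset ι) (c : ι → ℝ)
    (a : ι → MarkedConfig → ℝ) (ha : ∀ i ∈ s, a i ∈ F.localObs) :
    F.fluct (∑ i ∈ s, c i • a i) = ∑ i ∈ s, c i • F.fluct (a i) := by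
  classical
  induction s using Finset.induction_on with
  | empty => simp
  | insert i s hi ih =>
    have hs : ∀ j ∈ s, a j ∈ F.localObs := fun j hj => ha j (Finset.mem_insert_of_mem hj)
    have hmem : ∑ j ∈ s, c j • a j ∈ F.localObs :=
      F.localObs.sum_mem fun j hj => F.localObs.smul_mem _ (hs j hj)
    rw [Finset.sum_insert hi, Finset.sum_insert hi,
      FluctuationStructure.fluct_add (F.localObs.smul_mem _ (ha i (Finset.mem_insert_self i s))) hmem,
      FluctuationStructure.fluct_smul _ (ha i (Finset.mem_insert_self i s)), ih hs]

/-- The five charge functions span exactly the collision invariants `span{1, v·e, |v|²}` of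
`Literature.Analysis.UnboundedOperators.collisionInvariants` (velocity space `ℝ³`). [folklore] -/
theorem span_range_chargeFn_eq_collisionInvariants :
    Submodule.span ℝ (Set.range chargeFn) =
      Literature.Analysis.UnboundedOperators.collisionInvariants V3 := by
  apply le_antisymm
  · exact Submodule.span_le.2 (by rintro _ ⟨i, rfl⟩; exact chargeFn_mem_collisionInvariants i)
  · rw [Literature.Analysis.UnboundedOperators.collisionInvariants, Submodule.span_le]
    have h0 : chargeFn 0 = fun _ : V3 => (1 : ℝ) := rfl
    have h4 : chargeFn 4 = fun v : V3 => ‖v‖ ^ 2 / 2 := rfl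
    have hc : ∀ k : Fin 3, (fun v : V3 => v k) ∈ Submodule.span ℝ (Set.range chargeFn) := by
      intro k
      fin_cases k
      · exact Submodule.subset_span ⟨1, rfl⟩
      · exact Submodule.subset_span ⟨2, rfl⟩
      · exact Submodule.subset_span ⟨3, rfl⟩
    rintro φ ((rfl | rfl) | ⟨e, rfl⟩)
    · rw [← h0]; exact Submodule.subset_span ⟨0, rfl⟩
    · have : (fun v : V3 => ‖v‖ ^ 2) = (2 : ℝ) • chargeFn 4 := by
        rw [h4]; funext v; simp only [Pi.smul_apply, smul_eq_mul]; ring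
      rw [this]
      exact Submodule.smul_mem _ _ (Submodule.subset_span ⟨4, rfl⟩)
    · have : (fun v : V3 => ⟪v, e⟫_ℝ) = ∑ k : Fin 3, e k • fun v : V3 => v k := by
        funext v
        simp only [Finset.sum_apply, Pi.smul_apply, smul_eq_mul]
        rw [EuclideanSpace.inner_eq_star_dotProduct]
        simp [dotProduct, Fin.sum_univ_three]
      change (fun v : V3 => ⟪v, e⟫_ℝ) ∈ _
      rw [this]
      exact Submodule.sum_mem _ fun k _ => Submodule.smul_mem _ _ (hc k)

/-- **Static half of one-body rigidity.** Under hard-sphere fluctuation data with `σ > 0`: a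
local observable which is a.e. a one-body cell observable `A_h` with COLLISION-INVARIANT profile
`h ∈ span{1, v_α, |v|²}` has its fluctuation class in the charge subspace `𝒞`:
`[a] ∈ span{q₀,…,q₄}`. (Write `h = Σ cᵢ eᵢ` in the charge functions; a.s. finitely many
particles lie in the cell, so `A_h = Σ cᵢ n_i` a.e., and `[·]` is linear and respects a.e.
equality.) This is the step "h ∈ collision invariants ⟹ ψ ∈ chargeSpace" of the item's plan;
no dynamics is used. [folklore] -/
theorem fluct_mem_chargeSpace_of_ae_eq_cellObs (F : HardSphereFluctuationData σ) (hσ : 0 < σ)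
    {a : MarkedConfig → ℝ} (ha : a ∈ F.localObs) {h : V3 → ℝ}
    (hh : h ∈ Literature.Analysis.UnboundedOperators.collisionInvariants V3)
    (hah : a =ᵐ[F.μ] cellObs h) : F.fluct a ∈ F.chargeSpace := by
  rw [← span_range_chargeFn_eq_collisionInvariants, Submodule.mem_span_range_iff_exists_fun] at hh
  obtain ⟨c, rfl⟩ := hh
  set b : MarkedConfig → ℝ := ∑ i, c i • cellCharge i with hb_def
  have hb : b ∈ F.localObs := F.localObs.sum_mem fun i _ => F.localObs.smul_mem _ (F.cellCharge_mem i)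
  have hab : a =ᵐ[F.μ] b := hah.trans (cellObs_finset_sum_ae F hσ Finset.univ c chargeFn)
  rw [FluctuationStructure.fluct_congr_ae ha hb hab, hb_def,
    fluct_finset_sum F Finset.univ c cellCharge fun i _ => F.cellCharge_mem i]
  exact F.chargeSpace.sum_mem fun i _ => F.chargeSpace.smul_mem _ (F.chargeClass_mem_chargeSpace i)

/-- Special case: the class of a one-body cell observable `A_h ∈ 𝒱` with collision-invariant
profile lies in `𝒞`. [folklore] -/
theorem fluct_cellObs_mem_chargeSpace (F : HardSphereFluctuationData σ) (hσ : 0 < σ) {h : V3 → ℝ}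
    (hmem : cellObs h ∈ F.localObs)
    (hh : h ∈ Literature.Analysis.UnboundedOperators.collisionInvariants V3) :
    F.fluct (cellObs h) ∈ F.chargeSpace :=
  fluct_mem_chargeSpace_of_ae_eq_cellObs F hσ hmem hh EventuallyEq.rfl

/-! ## The dynamical side: what differentiability of the orbit gives -/

/-- On the domain of the generator the orbit moves linearly: `U_t ψ − ψ = O(t)` as `t → 0`. [folklore] -/
theorem isBigO_koopman_sub_self (F : HardSphereFluctuationData σ) {ψ : HardSphereFluctuationSpace F}
    (hψ : ψ ∈ F.generatorDomain) :
    (fun t : ℝ => F.koopman t ψ - ψ) =O[𝓝 0] fun t => t := by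
  have h := (F.hasDerivAt_koopman ⟨ψ, hψ⟩).isBigO_sub
  simp only [FluctuationDynamics.koopman_zero_apply, sub_zero] at h
  exact h

/-- On the domain of the generator, `‖U_t ψ − ψ‖² = o(t)` as `t → 0⁺`: the orbit has no
`√t`-cusp. This is the ONLY property of `generatorDomain` the rigidity item consumes. [folklore] -/
theorem isLittleO_norm_koopman_sub_self_sq (F : HardSphereFluctuationData σ)
    {ψ : HardSphereFluctuationSpace F} (hψ : ψ ∈ F.generatorDomain) :
    (fun t : ℝ => ‖F.koopman t ψ - ψ‖ ^ 2) =o[𝓝[>] 0] fun t => t := by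
  have h1 : (fun t : ℝ => ‖F.koopman t ψ - ψ‖ ^ 2) =O[𝓝 0] fun t => t ^ 2 := by
    simpa [pow_two] using ((isBigO_koopman_sub_self F hψ).norm_left.mul
      (isBigO_koopman_sub_self F hψ).norm_left)
  have h2 : (fun t : ℝ => t ^ 2) =o[𝓝 0] fun t => t := by
    simpa using (Asymptotics.isLittleO_pow_id (n := 2) one_lt_two (𝕜 := ℝ))
  exact (h1.trans_isLittleO h2).mono nhdsWithin_le_nhds

/-- **Reduction of the item to the `√t`-dichotomy on the closed one-body sector.** If, under the
hypotheses of the item (low-activity Gibbs state, flow a.e. equal to an equilibrium Alexander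
flow), every vector `ψ` of the CLOSED one-body sector `𝒟` whose orbit satisfies
`‖U_t ψ − ψ‖² = o(t)` (`t → 0⁺`) is a charge, then `OneBodySectorRigidity` holds. The hypothesis is
the short-time collision dichotomy expected of the hard-sphere Koopman group (for `ψ = [A_h]`,
`t⁻¹‖U_t ψ − ψ‖²` should tend to a positive multiple of the linearised hard-sphere Dirichlet form
of `h`, whose kernel is the collision invariants — Lebowitz–Percus–Sykes 1969; CIP 1994 §7.2),
stated UNIFORMLY on the closure `𝒟`; it is not a theorem of the literature for the infinite
system and is isolated here as the exact analytic input the item needs. [folklore] -/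
theorem oneBodySectorRigidity_of_sqrt_dichotomy
    (H : ∀ σ : ℝ, 0 < σ → ∀ β : ℝ, 0 < β → ∃ z₀ : ℝ, 0 < z₀ ∧ ∀ z : ℝ, 0 < z → z < z₀ →
      ∀ F : HardSphereFluctuationData σ,
        IsHardSphereGibbs σ z β (0 : V3) F.μ →
        (∃ Φ : InfiniteHardSphereFlow (Fin 3) σ, Φ.IsEquilibriumFlow ∧
          ∀ t : ℝ, F.flow t =ᵐ[F.μ] Φ.flow t) →
        ∀ ψ ∈ F.oneBodySector,
          ((fun t : ℝ => ‖F.koopman t ψ - ψ‖ ^ 2) =o[𝓝[>] 0] fun t => t) → ψ ∈ F.chargeSpace) :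
    Summit.AtomisticToContinuum.HydrodynamicLimit.Theses.MourreKoopmanCharges.OneBodySectorRigidity := by
  intro σ hσ β hβ
  obtain ⟨z₀, hz₀, hz⟩ := H σ hσ β hβ
  refine ⟨z₀, hz₀, fun z hz1 hz2 F hG hΦ ψ hψ => ?_⟩
  exact hz z hz1 hz2 F hG hΦ ψ hψ.1 (isLittleO_norm_koopman_sub_self_sq F hψ.2)

end Summit.AtomisticToContinuum.HydrodynamicLimit.Theorems.OneBodySectorRigidity

end
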